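import Mathlib.LinearAlgebra.Matrix.Permanent
import Mathlib.Analysis.Complex.Basic
import Mathlib.Analysis.SpecialFunctions.Exp
import Mathlib.Data.Fintype.Perm
import Mathlib.Data.Fintype.BigOperators
import Mathlib.Algebra.Order.BigOperators.Ring.Finset
import Mathlib.Analysis.SpecialFunctions.Pow.Real
import HarnessLib

/-!
# Column perturbations of the permanent: `Per(Y(1+E)) - Per(Y)` and its second moment

Topic `LinearAlgebra/Matrix` (elementary permanent combinatorics with a finite-probability tail).
Written for the discharge of Aaronson–Arkhipov's Main Theorem (S. Aaronson, A. Arkhipov, *The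
computational complexity of linear optics*, Theory of Computing 9 (2013) 143–252, Thm. 1.3; the
named fact `Literature.Computability.QuantumComplexity.gpeSolvableInFBPPRel_NPRel_of_approxBosonSamplingOracle`),
whose finite-precision hiding step (see `QuantumComplexity/BosonSamplingMainTheorem.lean`) plants
the Gaussian matrix `Y` in a tall matrix `B` and orthonormalises the columns of `B` by Gram–Schmidt:
the planted block of the resulting column-orthonormal matrix is `Y · T · D^{-1/2}` with `T` unit
upper triangular and CLOSE TO THE IDENTITY, so one needs to control `Per(Y T) - Per(Y)` for
`T = 1 + E`, `E` strictly upper triangular and small. Everything here is proved, Mathlib only.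

## Results

* `permanent_mul_eq_sum` — the multilinear column expansion
  `Per(Y C) = ∑_{g : ι → ι} (∏ₖ C (g k) k) · Per(Y^g)`, `Y^g = Y.submatrix id g` (column `k` of
  `Y^g` is column `g k` of `Y`), over any commutative ring.
* `norm_permanent_mul_one_add_sub_le` — **deterministic bound**: for `E` strictly upper triangular
  with `|E j k| ≤ η`, `|Per(Y(1+E)) - Per(Y)| ≤ Z_η(Y) := ∑_{g ≠ id} η^{#moved g} |Per(Y^g)|`
  (`perturbSum`; `moved g = #{k | g k ≠ k}`).
* `arrayExpect_norm_permanent_submatrix_sq_le` — **second moments under a product law**: if the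
  entries of `Y` are independent with a common MEAN-ZERO law of second moment `s` (finite seed type
  `A`, weights `p`, entry map `y`; `arrayExpect`, `seedMatrix`), then
  `E|Per(Y^g)|² ≤ sⁿ · n! · n^{2 #moved g}` for every column map `g`; for `g = id` this is
  Aaronson–Arkhipov's computation `E|Per X|² = n!` (AA13 §7; `arrayExpect_norm_permanent_sq_le`).
  Proof: `E` of the `(σ, τ)` Leibniz pair is `sⁿ` if `g ∘ σ⁻¹ = g ∘ τ⁻¹` and `0` otherwise
  (`sum_arrayWeight_mul_permPair`: rows are independent, and inside a row `E[y ȳ'] = 0` for two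
  distinct entries, `= s` for the same entry), and
  `#{(σ, τ) | g ∘ σ⁻¹ = g ∘ τ⁻¹} = n! · #Stab(g) ≤ n! · n^{2 #moved g}` (`card_stabPerms_le`: a
  permutation with `g ∘ ρ = g` is determined by its values on the `≤ 2 #moved g` points sharing
  their `g`-value).
* `arrayExpect_perturbSum_sq_le` — **`E[Z_η(Y)²] ≤ 4 η² n⁶ · sⁿ n!`** for `η n³ ≤ 1`, by Minkowski in
  `L²` (`arrayExpect_mul_le_sqrt_mul_sqrt`) and the generating function
  `∑_g x^{#moved g} = (1 + (n-1)x)ⁿ` (`sum_pow_moved_eq`, `sum_erase_id_pow_moved_le`).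

So a random strictly upper triangular perturbation of size `η` changes `Per(Y)` by
`O(η n³ √(sⁿ n!))` in `L²`, negligible against the typical size `√(sⁿ n!)` of `Per(Y)` once
`η ≪ n⁻³`; only Chebyshev/Markov are needed downstream. The constants are not optimised.

## Design

* Expectations are finite weighted sums `∑_ω (∏_{r,c} p(ω r c)) F(ω)` over arrays of seeds
  `ω : Fin n → Fin n → A` (no measure theory), the form in which the hiding analysis consumes them
  (the seeds are blocks of coin flips); independence is the product structure and Fubini is
  `Finset.prod_univ_sum`.
* Only `E[y] = 0` and `E|y|² = s` of the entry law enter: in a Leibniz pair every matrix entry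
  occurs at most once plain and at most once conjugated, so no higher moments appear — this is why
  the Gaussian computation of AA13 §7 holds verbatim for any mean-zero product law.

## References

* S. Aaronson, A. Arkhipov, *The computational complexity of linear optics*, Theory of Computing 9
  (2013) 143–252, §7 (`E[|Per(X)|²] = n!` for i.i.d. standard complex Gaussian entries).
* H. Minc, *Permanents*, Encyclopedia Math. Appl. 6, Addison–Wesley 1978, §1.2 (multilinearity of
  the permanent in rows and columns). (Standard; proved here from the Leibniz formula.)
-/

namespace Literature.LinearAlgebra.Matrix

open Finset Matrix

section Expansion

variable {ι : Type*} [Fintype ι] [DecidableEq ι] {R : Type*} [CommRing R]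

/-- **Multilinear column expansion of the permanent of a product.** Column `k` of `Y * C` is
`∑ⱼ C j k • (column j of Y)`, and the permanent is multilinear in the columns, so
`Per(Y C) = ∑_{g : ι → ι} (∏ₖ C (g k) k) · Per(Y^g)`, where `Y^g = Y.submatrix id g` is the matrix
whose `k`-th column is column `g k` of `Y` (columns may repeat). [folklore] -/
theorem permanent_mul_eq_sum (Y C : _root_.Matrix ι ι R) :
    (Y * C).permanent = ∑ g : ι → ι, (∏ k, C (g k) k) * (Y.submatrix id g).permanent := by
  classical
  unfold Matrix.permanent
  have key : ∀ σ : Equiv.Perm ι,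
      (∏ i, (Y * C) (σ i) i) = ∑ g : ι → ι, ∏ i, (Y (σ i) (g i) * C (g i) i) := by
    intro σ
    simp only [Matrix.mul_apply]
    rw [Finset.prod_univ_sum]
    simp only [Fintype.piFinset_univ]
  simp_rw [key]
  rw [Finset.sum_comm]
  refine Finset.sum_congr rfl fun g _ => ?_
  rw [Finset.mul_sum]
  refine Finset.sum_congr rfl fun σ _ => ?_
  rw [Finset.prod_mul_distrib, mul_comm]
  simp [Matrix.submatrix_apply]

end Expansion

/-! ### The perturbation sum `Z_η(Y)` and the deterministic bound -/

section Perturbation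

variable {n : ℕ}

/-- The number of points moved by a self-map `g` of `Fin n`: `#{k | g k ≠ k}`. [folklore] -/
def moved (g : Fin n → Fin n) : ℕ := (univ.filter fun k => g k ≠ k).card

/-- The identity moves nothing. [folklore] -/
@[simp] theorem moved_id : moved (id : Fin n → Fin n) = 0 := by
  simp [moved]

/-- **The perturbation sum** `Z_η(Y) = ∑_{g ≠ id} η^{#moved g} · |Per(Y^g)|` over all self-maps
`g ≠ id` of the column indices, `Y^g = Y.submatrix id g`. It dominates `|Per(Y(1+E)) - Per(Y)|`
for every strictly upper triangular `E` with entries bounded by `η`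
(`norm_permanent_mul_one_add_sub_le`). [folklore] -/
noncomputable def perturbSum (η : ℝ) (Y : _root_.Matrix (Fin n) (Fin n) ℂ) : ℝ :=
  ∑ g ∈ (univ : Finset (Fin n → Fin n)).erase id, η ^ moved g * ‖(Y.submatrix id g).permanent‖

/-- `Z_η(Y) ≥ 0` for `η ≥ 0`. [folklore] -/
theorem perturbSum_nonneg {η : ℝ} (hη : 0 ≤ η) (Y : _root_.Matrix (Fin n) (Fin n) ℂ) :
    0 ≤ perturbSum η Y :=
  Finset.sum_nonneg fun _ _ => mul_nonneg (pow_nonneg hη _) (norm_nonneg _)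

/-- For `E` strictly upper triangular with `|E j k| ≤ η`, the coefficient of `Per(Y^g)` in the
column expansion of `Per(Y(1+E))` has modulus at most `η^{#moved g}`: a fixed column contributes
the factor `1 + E k k = 1`, a moved one the factor `E (g k) k`, which is `0` or of modulus `≤ η`.
[folklore] -/
theorem norm_prod_one_add_apply_le (E : _root_.Matrix (Fin n) (Fin n) ℂ)
    (hE : ∀ j k, k ≤ j → E j k = 0) {η : ℝ} (hEη : ∀ j k, ‖E j k‖ ≤ η)
    (g : Fin n → Fin n) :
    ‖∏ k, (1 + E) (g k) k‖ ≤ η ^ moved g := by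
  rw [norm_prod]
  have hrhs : η ^ moved g = ∏ k, (if g k = k then (1 : ℝ) else η) := by
    rw [Finset.prod_ite, Finset.prod_const_one, one_mul, Finset.prod_const]
    rfl
  rw [hrhs]
  refine Finset.prod_le_prod (fun k _ => norm_nonneg _) fun k _ => ?_
  rw [Matrix.add_apply]
  split_ifs with hk
  · rw [hk, Matrix.one_apply_eq, hE k k le_rfl, add_zero, norm_one]
  · rw [Matrix.one_apply_ne hk, zero_add]
    exact hEη _ _

/-- **Deterministic perturbation bound.** For every strictly upper triangular `E` with entries of
modulus at most `η`,
`|Per(Y(1 + E)) - Per(Y)| ≤ Z_η(Y) = ∑_{g ≠ id} η^{#moved g} |Per(Y^g)|`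
(column expansion `permanent_mul_eq_sum`; the term `g = id` is `Per(Y)` itself because the
diagonal of `E` vanishes). [folklore] -/
theorem norm_permanent_mul_one_add_sub_le (Y E : _root_.Matrix (Fin n) (Fin n) ℂ)
    (hE : ∀ j k, k ≤ j → E j k = 0) {η : ℝ} (hEη : ∀ j k, ‖E j k‖ ≤ η) :
    ‖(Y * (1 + E)).permanent - Y.permanent‖ ≤ perturbSum η Y := by
  rw [permanent_mul_eq_sum, ← Finset.add_sum_erase _ _ (mem_univ id)]
  have hid : (∏ k, (1 + E) ((id : Fin n → Fin n) k) k) * (Y.submatrix id id).permanent =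
      Y.permanent := by
    have h1 : ∏ k, (1 + E) ((id : Fin n → Fin n) k) k = 1 :=
      Finset.prod_eq_one fun k _ => by
        rw [id, Matrix.add_apply, Matrix.one_apply_eq, hE k k le_rfl, add_zero]
    rw [h1, one_mul, Matrix.submatrix_id_id]
  rw [hid, add_sub_cancel_left]
  refine (norm_sum_le _ _).trans (Finset.sum_le_sum fun g _ => ?_)
  rw [norm_mul]
  exact mul_le_mul_of_nonneg_right (norm_prod_one_add_apply_le E hE hEη g) (norm_nonneg _)

end Perturbation

/-! ### Counting: pairs of permutations identified by a column map -/

section Counting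

variable {n : ℕ}

/-- The points of `Fin n` that share their `g`-value with another point. [folklore] -/
def sharedPts (g : Fin n → Fin n) : Finset (Fin n) :=
  univ.filter fun k => ∃ k', k' ≠ k ∧ g k' = g k

/-- A point sharing its value lies in the moved set or in its image: `#shared ≤ 2 · #moved`.
[folklore] -/
theorem card_sharedPts_le (g : Fin n → Fin n) : (sharedPts g).card ≤ 2 * moved g := by
  classical
  set D : Finset (Fin n) := univ.filter fun k => g k ≠ k with hD
  have hsub : sharedPts g ⊆ D ∪ D.image g := by
    intro k hk
    simp only [sharedPts, mem_filter, mem_univ, true_and] at hk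
    obtain ⟨k', hk'k, hgk⟩ := hk
    rw [mem_union]
    by_cases hgkk : g k = k
    · right
      rw [mem_image]
      refine ⟨k', ?_, by rw [hgk, hgkk]⟩
      rw [hD, mem_filter]
      exact ⟨mem_univ _, by rw [hgk, hgkk]; exact hk'k.symm⟩
    · left
      rw [hD, mem_filter]
      exact ⟨mem_univ _, hgkk⟩
  calc (sharedPts g).card ≤ (D ∪ D.image g).card := card_le_card hsub
    _ ≤ D.card + (D.image g).card := card_union_le _ _
    _ ≤ D.card + D.card := Nat.add_le_add_left card_image_le _
    _ = 2 * moved g := by rw [moved, ← hD]; ring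

/-- The stabiliser `{ρ | g ∘ ρ = g}` of `g` in the symmetric group, as a finset. [folklore] -/
def stabPerms (g : Fin n → Fin n) : Finset (Equiv.Perm (Fin n)) :=
  univ.filter fun ρ => g ∘ ρ = g

/-- A permutation stabilising `g` fixes every point that does not share its value. [folklore] -/
theorem apply_eq_self_of_mem_stabPerms {g : Fin n → Fin n} {ρ : Equiv.Perm (Fin n)}
    (hρ : ρ ∈ stabPerms g) {k : Fin n} (hk : k ∉ sharedPts g) : ρ k = k := by
  simp only [stabPerms, mem_filter, mem_univ, true_and] at hρ
  simp only [sharedPts, mem_filter, mem_univ, true_and, not_exists, not_and] at hk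
  by_contra h
  exact hk (ρ k) h (congr_fun hρ k)

/-- **The stabiliser is small**: `#{ρ | g ∘ ρ = g} ≤ n^{#shared} ≤ n^{2 #moved g}` — a stabilising
permutation is determined by its values on the shared points. (Exactly, the stabiliser has
`∏_c (#g⁻¹ c)!` elements; only this bound is needed.) [folklore] -/
theorem card_stabPerms_le (g : Fin n → Fin n) : (stabPerms g).card ≤ n ^ (2 * moved g) := by
  classical
  have hinj : Set.InjOn (fun ρ : Equiv.Perm (Fin n) => fun k : sharedPts g => ρ k)
      (stabPerms g : Set (Equiv.Perm (Fin n))) := by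
    intro ρ₁ h₁ ρ₂ h₂ heq
    refine Equiv.ext fun k => ?_
    by_cases hk : k ∈ sharedPts g
    · exact congr_fun heq ⟨k, hk⟩
    · rw [apply_eq_self_of_mem_stabPerms h₁ hk, apply_eq_self_of_mem_stabPerms h₂ hk]
  have h1 : (stabPerms g).card ≤ (univ : Finset (sharedPts g → Fin n)).card :=
    Finset.card_le_card_of_injOn _ (fun _ _ => mem_univ _) hinj
  rw [card_univ, Fintype.card_fun, Fintype.card_fin, Fintype.card_coe] at h1
  calc (stabPerms g).card ≤ n ^ (sharedPts g).card := h1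
    _ ≤ n ^ (2 * moved g) := by
        rcases Nat.eq_zero_or_pos n with hn | hn
        · subst hn
          have : moved g = 0 := by simp [moved]
          have h2 : (sharedPts g).card = 0 := by simp [sharedPts]
          rw [this, h2]
        · exact Nat.pow_le_pow_right hn (card_sharedPts_le g)

/-- For a fixed `σ`, the permutations `τ` with `g ∘ σ⁻¹ = g ∘ τ⁻¹` are the `σ ρ`, `ρ` in the
stabiliser of `g`; hence there are at most `n^{2 #moved g}` of them. [folklore] -/
theorem card_filter_comp_symm_eq_le (g : Fin n → Fin n) (σ : Equiv.Perm (Fin n)) :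
    (univ.filter fun τ : Equiv.Perm (Fin n) => g ∘ σ.symm = g ∘ τ.symm).card ≤
      n ^ (2 * moved g) := by
  classical
  have hsub : (univ.filter fun τ : Equiv.Perm (Fin n) => g ∘ σ.symm = g ∘ τ.symm) ⊆
      (stabPerms g).image fun ρ => σ * ρ := by
    intro τ hτ
    simp only [mem_filter, mem_univ, true_and] at hτ
    rw [mem_image]
    refine ⟨σ⁻¹ * τ, ?_, by group⟩
    simp only [stabPerms, mem_filter, mem_univ, true_and]
    funext k
    have := congr_fun hτ (τ k)
    simp only [Function.comp_apply, Equiv.symm_apply_apply] at this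
    simp only [Function.comp_apply, Equiv.Perm.mul_apply, Equiv.Perm.inv_def]
    exact this
  calc _ ≤ ((stabPerms g).image fun ρ => σ * ρ).card := card_le_card hsub
    _ ≤ (stabPerms g).card := card_image_le
    _ ≤ n ^ (2 * moved g) := card_stabPerms_le g

/-- **Pairs of permutations identified by `g`**: `#{(σ, τ) | g ∘ σ⁻¹ = g ∘ τ⁻¹} ≤ n! · n^{2 #moved g}`
(written as an iterated sum of indicators). [folklore] -/
theorem sum_sum_ite_comp_symm_eq_le (g : Fin n → Fin n) (x : ℝ) (hx : 0 ≤ x) :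
    (∑ σ : Equiv.Perm (Fin n), ∑ τ : Equiv.Perm (Fin n),
        if g ∘ σ.symm = g ∘ τ.symm then x else 0) ≤ n.factorial * n ^ (2 * moved g) * x := by
  classical
  have hσ : ∀ σ : Equiv.Perm (Fin n),
      (∑ τ : Equiv.Perm (Fin n), if g ∘ σ.symm = g ∘ τ.symm then x else 0) ≤
        n ^ (2 * moved g) * x := by
    intro σ
    rw [← Finset.sum_filter, Finset.sum_const, nsmul_eq_mul]
    exact mul_le_mul_of_nonneg_right (by exact_mod_cast card_filter_comp_symm_eq_le g σ) hx
  calc _ ≤ ∑ _σ : Equiv.Perm (Fin n), (n : ℝ) ^ (2 * moved g) * x := Finset.sum_le_sum fun σ _ => hσ σ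
    _ = n.factorial * n ^ (2 * moved g) * x := by
        rw [Finset.sum_const, card_univ, Fintype.card_perm, Fintype.card_fin, nsmul_eq_mul]
        ring

end Counting

/-! ### Second moments under a product law on the entries -/

section Moments

variable {n : ℕ} {A : Type*}

/-- The product weight of an `n × n` array of independent seeds: `∏_{r,c} p(ω r c)`. [folklore] -/
def arrayWeight (p : A → ℝ) (ω : Fin n → Fin n → A) : ℝ := ∏ r, ∏ c, p (ω r c)

/-- The matrix of entries `y(ω r c)` read off an array of seeds. [folklore] -/
def seedMatrix (y : A → ℂ) (ω : Fin n → Fin n → A) : _root_.Matrix (Fin n) (Fin n) ℂ :=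
  Matrix.of fun r c => y (ω r c)

/-- Product weights are nonnegative. [folklore] -/
theorem arrayWeight_nonneg {p : A → ℝ} (hp : ∀ a, 0 ≤ p a) (ω : Fin n → Fin n → A) :
    0 ≤ arrayWeight p ω :=
  Finset.prod_nonneg fun _ _ => Finset.prod_nonneg fun _ _ => hp _

/-- Reindexing a Leibniz term by rows: `∏ᵢ y(ω (π i) (g i)) = ∏ᵣ y(ω r (g (π⁻¹ r)))`. [folklore] -/
theorem prod_perm_reindex (y : A → ℂ) (ω : Fin n → Fin n → A) (g : Fin n → Fin n)
    (π : Equiv.Perm (Fin n)) :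
    (∏ i, y (ω (π i) (g i))) = ∏ r, y (ω r (g (π.symm r))) := by
  rw [← Equiv.prod_comp π (fun r => y (ω r (g (π.symm r))))]
  simp

variable [Fintype A]

/-- Expectation under the product law: `E_p[F] = ∑_ω (∏_{r,c} p(ω r c)) F(ω)`. [folklore] -/
def arrayExpect (p : A → ℝ) (F : (Fin n → Fin n → A) → ℝ) : ℝ := ∑ ω, arrayWeight p ω * F ω

/-- Monotonicity of the expectation. [folklore] -/
theorem arrayExpect_mono {p : A → ℝ} (hp : ∀ a, 0 ≤ p a) {F G : (Fin n → Fin n → A) → ℝ}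
    (h : ∀ ω, F ω ≤ G ω) : arrayExpect p F ≤ arrayExpect p G :=
  Finset.sum_le_sum fun ω _ => mul_le_mul_of_nonneg_left (h ω) (arrayWeight_nonneg hp ω)

/-- The expectation of a nonnegative function is nonnegative. [folklore] -/
theorem arrayExpect_nonneg {p : A → ℝ} (hp : ∀ a, 0 ≤ p a) {F : (Fin n → Fin n → A) → ℝ}
    (h : ∀ ω, 0 ≤ F ω) : 0 ≤ arrayExpect p F :=
  Finset.sum_nonneg fun ω _ => mul_nonneg (arrayWeight_nonneg hp ω) (h ω)

/-- **Rows are independent**: the expectation of a product of row functions is the product of the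
row expectations (finite Fubini, `Finset.prod_univ_sum`). [folklore] -/
theorem sum_arrayWeight_mul_prod_rows (p : A → ℝ) (φ : Fin n → (Fin n → A) → ℂ) :
    ∑ ω : Fin n → Fin n → A, (arrayWeight p ω : ℂ) * ∏ r, φ r (ω r) =
      ∏ r, ∑ row : Fin n → A, ((∏ c, p (row c) : ℝ) : ℂ) * φ r row := by
  rw [Finset.prod_univ_sum]
  simp only [Fintype.piFinset_univ]
  refine Finset.sum_congr rfl fun ω _ => ?_
  rw [arrayWeight, Finset.prod_mul_distrib]
  push_cast
  rfl

/-- **Entries of a row are independent**: the same factorisation inside one row. [folklore] -/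
theorem sum_rowWeight_mul_prod_cols (p : A → ℝ) (ψ : Fin n → A → ℂ) :
    ∑ row : Fin n → A, ((∏ c, p (row c) : ℝ) : ℂ) * ∏ c, ψ c (row c) =
      ∏ c, ∑ a, (p a : ℂ) * ψ c a := by
  rw [Finset.prod_univ_sum]
  simp only [Fintype.piFinset_univ]
  refine Finset.sum_congr rfl fun row _ => ?_
  push_cast
  rw [← Finset.prod_mul_distrib]

/-- **Pair moments of one row.** For a mean-zero entry law (`∑ p y = 0`) with second moment
`s = ∑ p |y|²`: `E[y(row a) · conj y(row b)] = s` if `a = b` and `0` otherwise. [folklore] -/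
theorem sum_rowWeight_mul_entry_mul_conj (p : A → ℝ) (hp1 : ∑ a, p a = 1) (y : A → ℂ)
    (hy : ∑ a, (p a : ℂ) * y a = 0) {s : ℝ} (hs : ∑ a, p a * ‖y a‖ ^ 2 = s) (a b : Fin n) :
    ∑ row : Fin n → A, ((∏ c, p (row c) : ℝ) : ℂ) * (y (row a) * (starRingEnd ℂ) (y (row b))) =
      if a = b then (s : ℂ) else 0 := by
  set ψ : Fin n → A → ℂ := fun c x =>
    (if c = a then y x else 1) * (if c = b then (starRingEnd ℂ) (y x) else 1) with hψ
  have hprod : ∀ row : Fin n → A,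
      y (row a) * (starRingEnd ℂ) (y (row b)) = ∏ c, ψ c (row c) := by
    intro row
    simp only [hψ, Finset.prod_mul_distrib, Finset.prod_ite_eq', mem_univ, if_true]
  simp_rw [hprod, sum_rowWeight_mul_prod_cols]
  have hone : ∀ c, c ≠ a → c ≠ b → ∑ x, (p x : ℂ) * ψ c x = 1 := by
    intro c hca hcb
    simp only [hψ, if_neg hca, if_neg hcb, mul_one]
    exact_mod_cast hp1
  by_cases hab : a = b
  · subst hab
    rw [if_pos rfl, ← Finset.mul_prod_erase univ _ (mem_univ a)]
    have ha : ∑ x, (p x : ℂ) * ψ a x = s := by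
      simp only [hψ]
      rw [← hs]
      push_cast
      refine Finset.sum_congr rfl fun x _ => ?_
      rw [Complex.mul_conj, Complex.normSq_eq_norm_sq]
      push_cast
      ring
    rw [ha, Finset.prod_congr rfl fun c hc => hone c (ne_of_mem_erase hc) (ne_of_mem_erase hc),
      Finset.prod_const_one, mul_one]
  · rw [if_neg hab]
    apply Finset.prod_eq_zero (mem_univ a)
    simp only [hψ, if_neg hab, mul_one]
    exact hy

/-- **Expectation of one `(σ, τ)` term of `|Per(Y^g)|²`**: it is `sⁿ` if `g ∘ σ⁻¹ = g ∘ τ⁻¹`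
(every row then carries a factor `E|y|² = s`) and `0` otherwise (some row carries a factor
`E[y] · E[ȳ'] = 0`). [cite: AaronsonArkhipovToC2013, §7 (second moment of the permanent, E|Per X|² = n!)] -/
theorem sum_arrayWeight_mul_permPair (p : A → ℝ) (hp1 : ∑ a, p a = 1) (y : A → ℂ)
    (hy : ∑ a, (p a : ℂ) * y a = 0) {s : ℝ} (hs : ∑ a, p a * ‖y a‖ ^ 2 = s)
    (g : Fin n → Fin n) (σ τ : Equiv.Perm (Fin n)) :
    ∑ ω : Fin n → Fin n → A, (arrayWeight p ω : ℂ) *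
        ((∏ i, y (ω (σ i) (g i))) * (starRingEnd ℂ) (∏ i, y (ω (τ i) (g i)))) =
      if g ∘ σ.symm = g ∘ τ.symm then (s : ℂ) ^ n else 0 := by
  have hterm : ∀ ω : Fin n → Fin n → A,
      (∏ i, y (ω (σ i) (g i))) * (starRingEnd ℂ) (∏ i, y (ω (τ i) (g i))) =
        ∏ r, (y (ω r ((g ∘ σ.symm) r)) * (starRingEnd ℂ) (y (ω r ((g ∘ τ.symm) r)))) := by
    intro ω
    rw [prod_perm_reindex y ω g σ, prod_perm_reindex y ω g τ, map_prod, ← Finset.prod_mul_distrib]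
    rfl
  simp_rw [hterm]
  rw [sum_arrayWeight_mul_prod_rows p
    (fun r row => y (row ((g ∘ σ.symm) r)) * (starRingEnd ℂ) (y (row ((g ∘ τ.symm) r))))]
  simp_rw [sum_rowWeight_mul_entry_mul_conj p hp1 y hy hs]
  by_cases h : g ∘ σ.symm = g ∘ τ.symm
  · rw [if_pos h]
    rw [Finset.prod_congr rfl fun r _ => if_pos (congr_fun h r), Finset.prod_const, card_univ,
      Fintype.card_fin]
  · rw [if_neg h]
    obtain ⟨r, hr⟩ : ∃ r, (g ∘ σ.symm) r ≠ (g ∘ τ.symm) r := by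
      by_contra hall
      push Not at hall
      exact h (funext hall)
    exact Finset.prod_eq_zero (mem_univ r) (if_neg hr)

/-- **Second moment of the permanent with repeated columns.** Under a product law with mean-zero
entries of second moment `s`, `E|Per(Y^g)|² ≤ sⁿ · n! · n^{2 #moved g}` for every column map `g`
(with equality `sⁿ n!` for `g = id`: Aaronson–Arkhipov's `E|Per X|² = n!`). [cite: AaronsonArkhipovToC2013, §7 (second moment of the permanent, E|Per X|² = n!)] -/
theorem arrayExpect_norm_permanent_submatrix_sq_le (p : A → ℝ) (hp : ∀ a, 0 ≤ p a)
    (hp1 : ∑ a, p a = 1) (y : A → ℂ) (hy : ∑ a, (p a : ℂ) * y a = 0) {s : ℝ}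
    (hs : ∑ a, p a * ‖y a‖ ^ 2 = s) (g : Fin n → Fin n) :
    arrayExpect p (fun ω => ‖((seedMatrix y ω).submatrix id g).permanent‖ ^ 2) ≤
      s ^ n * (n.factorial * n ^ (2 * moved g)) := by
  have hs0 : 0 ≤ s := by rw [← hs]; exact Finset.sum_nonneg fun a _ => mul_nonneg (hp a) (sq_nonneg _)
  -- the expectation, as a complex number, is the double sum of the pair terms
  have hC : (arrayExpect p (fun ω => ‖((seedMatrix y ω).submatrix id g).permanent‖ ^ 2) : ℂ) =
      ∑ σ : Equiv.Perm (Fin n), ∑ τ : Equiv.Perm (Fin n),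
        if g ∘ σ.symm = g ∘ τ.symm then (s : ℂ) ^ n else 0 := by
    unfold arrayExpect
    have hsq : ∀ ω : Fin n → Fin n → A,
        ((‖((seedMatrix y ω).submatrix id g).permanent‖ ^ 2 : ℝ) : ℂ) =
          ∑ σ : Equiv.Perm (Fin n), ∑ τ : Equiv.Perm (Fin n),
            (∏ i, y (ω (σ i) (g i))) * (starRingEnd ℂ) (∏ i, y (ω (τ i) (g i))) := by
      intro ω
      rw [← Complex.normSq_eq_norm_sq, ← Complex.mul_conj]
      simp only [Matrix.permanent, Matrix.submatrix_apply, seedMatrix, Matrix.of_apply, id,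
        map_sum, Finset.sum_mul_sum]
    rw [Complex.ofReal_sum]
    simp_rw [Complex.ofReal_mul, hsq, Finset.mul_sum]
    rw [Finset.sum_comm]
    refine Finset.sum_congr rfl fun σ _ => ?_
    rw [Finset.sum_comm]
    refine Finset.sum_congr rfl fun τ _ => ?_
    exact sum_arrayWeight_mul_permPair p hp1 y hy hs g σ τ
  have hR : arrayExpect p (fun ω => ‖((seedMatrix y ω).submatrix id g).permanent‖ ^ 2) =
      ∑ σ : Equiv.Perm (Fin n), ∑ τ : Equiv.Perm (Fin n),
        if g ∘ σ.symm = g ∘ τ.symm then s ^ n else 0 := by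
    have : ((∑ σ : Equiv.Perm (Fin n), ∑ τ : Equiv.Perm (Fin n),
        if g ∘ σ.symm = g ∘ τ.symm then s ^ n else 0 : ℝ) : ℂ) =
        ∑ σ : Equiv.Perm (Fin n), ∑ τ : Equiv.Perm (Fin n),
          if g ∘ σ.symm = g ∘ τ.symm then (s : ℂ) ^ n else 0 := by
      rw [Complex.ofReal_sum]
      refine Finset.sum_congr rfl fun σ _ => ?_
      rw [Complex.ofReal_sum]
      refine Finset.sum_congr rfl fun τ _ => ?_
      split_ifs <;> simp
    exact_mod_cast hC.trans this.symm
  rw [hR]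
  calc _ ≤ (n.factorial : ℝ) * n ^ (2 * moved g) * s ^ n :=
        sum_sum_ite_comp_symm_eq_le g (s ^ n) (pow_nonneg hs0 n)
    _ = s ^ n * (n.factorial * n ^ (2 * moved g)) := by ring

/-- **`E|Per Y|² ≤ sⁿ n!`** (the case `g = id`). [cite: AaronsonArkhipovToC2013, §7 (second moment of the permanent, E|Per X|² = n!)] -/
theorem arrayExpect_norm_permanent_sq_le (p : A → ℝ) (hp : ∀ a, 0 ≤ p a) (hp1 : ∑ a, p a = 1)
    (y : A → ℂ) (hy : ∑ a, (p a : ℂ) * y a = 0) {s : ℝ} (hs : ∑ a, p a * ‖y a‖ ^ 2 = s) :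
    arrayExpect p (fun ω : Fin n → Fin n → A => ‖(seedMatrix y ω).permanent‖ ^ 2) ≤
      s ^ n * n.factorial := by
  have h := arrayExpect_norm_permanent_submatrix_sq_le p hp hp1 y hy hs (id : Fin n → Fin n)
  simpa using h

/-! ### The second moment of the perturbation sum -/

/-- `x^{#moved g}` as a product over the points. [folklore] -/
theorem pow_moved_eq_prod (x : ℝ) (g : Fin n → Fin n) :
    x ^ moved g = ∏ k, (if g k = k then (1 : ℝ) else x) := by
  rw [Finset.prod_ite, Finset.prod_const_one, one_mul, Finset.prod_const]
  rfl

/-- **Generating function of the number of moved points**: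
`∑_{g : Fin n → Fin n} x^{#moved g} = (1 + (n-1) x)ⁿ` (each point independently stays, weight `1`,
or moves to one of the `n - 1` other values, weight `x`). [folklore] -/
theorem sum_pow_moved_eq (x : ℝ) :
    ∑ g : Fin n → Fin n, x ^ moved g = (1 + ((n - 1 : ℕ) : ℝ) * x) ^ n := by
  simp_rw [pow_moved_eq_prod]
  rw [← Fintype.piFinset_univ, ← Finset.prod_univ_sum (t := fun _ : Fin n => (univ : Finset (Fin n)))
    (f := fun k j => if j = k then (1 : ℝ) else x)]
  have hk : ∀ k : Fin n, (∑ j, if j = k then (1 : ℝ) else x) = 1 + ((n - 1 : ℕ) : ℝ) * x := by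
    intro k
    rw [← Finset.add_sum_erase _ _ (mem_univ k), if_pos rfl,
      Finset.sum_congr rfl fun j hj => if_neg (ne_of_mem_erase hj), Finset.sum_const,
      Finset.card_erase_of_mem (mem_univ k), card_univ, Fintype.card_fin, nsmul_eq_mul]
  rw [Finset.prod_congr rfl fun k _ => hk k, Finset.prod_const, card_univ, Fintype.card_fin]

/-- **Few maps move few points, quantitatively**: for `0 ≤ x` with `n² x ≤ 1`,
`∑_{g ≠ id} x^{#moved g} = (1 + (n-1)x)ⁿ - 1 ≤ e^{n² x} - 1 ≤ 2 n² x`. [folklore] -/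
theorem sum_erase_id_pow_moved_le {x : ℝ} (hx : 0 ≤ x) (hnx : (n : ℝ) ^ 2 * x ≤ 1) :
    ∑ g ∈ (univ : Finset (Fin n → Fin n)).erase id, x ^ moved g ≤ 2 * (n : ℝ) ^ 2 * x := by
  rw [Finset.sum_erase_eq_sub (mem_univ _), moved_id, pow_zero, sum_pow_moved_eq]
  have hn1 : ((n - 1 : ℕ) : ℝ) ≤ n := by exact_mod_cast Nat.sub_le n 1
  have h1 : (1 + ((n - 1 : ℕ) : ℝ) * x) ^ n ≤ Real.exp ((n : ℝ) ^ 2 * x) := by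
    calc (1 + ((n - 1 : ℕ) : ℝ) * x) ^ n ≤ (1 + (n : ℝ) * x) ^ n := by
          apply pow_le_pow_left₀ (by positivity)
          nlinarith
      _ ≤ Real.exp ((n : ℝ) * x) ^ n := by
          apply pow_le_pow_left₀ (by positivity)
          have := Real.add_one_le_exp ((n : ℝ) * x)
          linarith
      _ = Real.exp ((n : ℝ) ^ 2 * x) := by rw [← Real.exp_nat_mul]; ring_nf
  have h2 : Real.exp ((n : ℝ) ^ 2 * x) - 1 ≤ 2 * ((n : ℝ) ^ 2 * x) := by
    have h0 : 0 ≤ (n : ℝ) ^ 2 * x := by positivity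
    have habs : |(n : ℝ) ^ 2 * x| ≤ 1 := by rw [abs_of_nonneg h0]; exact hnx
    have := Real.abs_exp_sub_one_le habs
    rw [abs_of_nonneg h0] at this
    exact (le_abs_self _).trans this
  linarith

/-- **Weighted Cauchy–Schwarz**: `E[X Y] ≤ √E[X²] · √E[Y²]` under the product law. [folklore] -/
theorem arrayExpect_mul_le_sqrt_mul_sqrt (p : A → ℝ) (hp : ∀ a, 0 ≤ p a)
    (X Y : (Fin n → Fin n → A) → ℝ) :
    arrayExpect p (fun ω => X ω * Y ω) ≤
      Real.sqrt (arrayExpect p fun ω => X ω ^ 2) * Real.sqrt (arrayExpect p fun ω => Y ω ^ 2) := by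
  have hw := arrayWeight_nonneg (n := n) hp
  have hcs := Finset.sum_mul_sq_le_sq_mul_sq (univ : Finset (Fin n → Fin n → A))
    (fun ω => Real.sqrt (arrayWeight p ω) * X ω) (fun ω => Real.sqrt (arrayWeight p ω) * Y ω)
  have e1 : ∑ ω, Real.sqrt (arrayWeight p ω) * X ω * (Real.sqrt (arrayWeight p ω) * Y ω) =
      arrayExpect p (fun ω => X ω * Y ω) := by
    unfold arrayExpect
    refine Finset.sum_congr rfl fun ω _ => ?_
    calc Real.sqrt (arrayWeight p ω) * X ω * (Real.sqrt (arrayWeight p ω) * Y ω)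
        = (Real.sqrt (arrayWeight p ω) * Real.sqrt (arrayWeight p ω)) * (X ω * Y ω) := by ring
      _ = arrayWeight p ω * (X ω * Y ω) := by rw [Real.mul_self_sqrt (hw ω)]
  have e2 : ∀ W : (Fin n → Fin n → A) → ℝ,
      ∑ ω, (Real.sqrt (arrayWeight p ω) * W ω) ^ 2 = arrayExpect p (fun ω => W ω ^ 2) := by
    intro W
    unfold arrayExpect
    refine Finset.sum_congr rfl fun ω _ => ?_
    rw [mul_pow, Real.sq_sqrt (hw ω)]
  rw [e1, e2 X, e2 Y] at hcs
  rw [← Real.sqrt_mul (arrayExpect_nonneg hp fun ω => sq_nonneg (X ω))]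
  exact (le_abs_self _).trans (Real.abs_le_sqrt hcs)

/-- **Second moment of the perturbation sum.** Under a product law with mean-zero entries of second
moment `s`, for `0 ≤ η` with `η n³ ≤ 1`:
`E[Z_η(Y)²] ≤ 4 η² n⁶ · sⁿ n!` — by Minkowski in `L²` over the maps `g ≠ id`
(`E[X_g X_h] ≤ ‖X_g‖₂ ‖X_h‖₂`), the column-map moments `‖Per(Y^g)‖₂ ≤ √(sⁿ n!) · n^{#moved g}`
and the generating-function bound `∑_{g ≠ id} (η n)^{#moved g} ≤ 2 η n³`. Together with
`norm_permanent_mul_one_add_sub_le` this controls `|Per(Y(1+E)) - Per(Y)|` in probability for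
random strictly upper triangular perturbations `E` of size `η`. [folklore] -/
theorem arrayExpect_perturbSum_sq_le (p : A → ℝ) (hp : ∀ a, 0 ≤ p a) (hp1 : ∑ a, p a = 1)
    (y : A → ℂ) (hy : ∑ a, (p a : ℂ) * y a = 0) {s : ℝ} (hs : ∑ a, p a * ‖y a‖ ^ 2 = s)
    {η : ℝ} (hη : 0 ≤ η) (hηn : η * (n : ℝ) ^ 3 ≤ 1) :
    arrayExpect p (fun ω : Fin n → Fin n → A => perturbSum η (seedMatrix y ω) ^ 2) ≤
      4 * η ^ 2 * (n : ℝ) ^ 6 * (s ^ n * n.factorial) := by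
  have hs0 : 0 ≤ s := by
    rw [← hs]; exact Finset.sum_nonneg fun a _ => mul_nonneg (hp a) (sq_nonneg _)
  set G : Finset (Fin n → Fin n) := (univ : Finset (Fin n → Fin n)).erase id with hG
  set a : (Fin n → Fin n) → ℝ := fun g => η ^ moved g with ha
  set X : (Fin n → Fin n) → (Fin n → Fin n → A) → ℝ :=
    fun g ω => ‖((seedMatrix y ω).submatrix id g).permanent‖ with hX
  have ha0 : ∀ g, 0 ≤ a g := fun g => pow_nonneg hη _
  have hZ : ∀ ω : Fin n → Fin n → A, perturbSum η (seedMatrix y ω) = ∑ g ∈ G, a g * X g ω :=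
    fun ω => rfl
  -- E[Z²] = Σ_g Σ_h a_g a_h E[X_g X_h]
  have hexp : arrayExpect p (fun ω : Fin n → Fin n → A => perturbSum η (seedMatrix y ω) ^ 2) =
      ∑ g ∈ G, ∑ h ∈ G, a g * a h * arrayExpect p (fun ω => X g ω * X h ω) := by
    unfold arrayExpect
    simp_rw [hZ, sq, Finset.sum_mul_sum, Finset.mul_sum]
    rw [Finset.sum_comm]
    refine Finset.sum_congr rfl fun g _ => ?_
    rw [Finset.sum_comm]
    refine Finset.sum_congr rfl fun h _ => Finset.sum_congr rfl fun ω _ => ?_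
    ring
  -- ‖X_g‖₂ ≤ √(sⁿ n!) n^{#moved g}
  have hB : ∀ g, Real.sqrt (arrayExpect p fun ω => X g ω ^ 2) ≤
      Real.sqrt (s ^ n * n.factorial) * (n : ℝ) ^ moved g := by
    intro g
    have h1 := arrayExpect_norm_permanent_submatrix_sq_le p hp hp1 y hy hs g
    calc Real.sqrt (arrayExpect p fun ω => X g ω ^ 2)
        ≤ Real.sqrt (s ^ n * (n.factorial * n ^ (2 * moved g))) := Real.sqrt_le_sqrt h1
      _ = Real.sqrt (s ^ n * n.factorial) * (n : ℝ) ^ moved g := by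
          rw [← mul_assoc, Real.sqrt_mul (by positivity), pow_mul', Real.sqrt_sq (by positivity)]
  -- Minkowski
  have step1 : arrayExpect p (fun ω : Fin n → Fin n → A => perturbSum η (seedMatrix y ω) ^ 2) ≤
      (∑ g ∈ G, a g * Real.sqrt (arrayExpect p fun ω => X g ω ^ 2)) ^ 2 := by
    rw [hexp, sq, Finset.sum_mul_sum]
    refine Finset.sum_le_sum fun g _ => Finset.sum_le_sum fun h _ => ?_
    have hcs := arrayExpect_mul_le_sqrt_mul_sqrt p hp (X g) (X h)
    calc a g * a h * arrayExpect p (fun ω => X g ω * X h ω)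
        ≤ a g * a h * (Real.sqrt (arrayExpect p fun ω => X g ω ^ 2) *
            Real.sqrt (arrayExpect p fun ω => X h ω ^ 2)) :=
          mul_le_mul_of_nonneg_left hcs (mul_nonneg (ha0 g) (ha0 h))
      _ = a g * Real.sqrt (arrayExpect p fun ω => X g ω ^ 2) *
            (a h * Real.sqrt (arrayExpect p fun ω => X h ω ^ 2)) := by ring
  have step2 : ∑ g ∈ G, a g * Real.sqrt (arrayExpect p fun ω => X g ω ^ 2) ≤
      Real.sqrt (s ^ n * n.factorial) * ∑ g ∈ G, (η * n) ^ moved g := by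
    rw [Finset.mul_sum]
    refine Finset.sum_le_sum fun g _ => ?_
    calc a g * Real.sqrt (arrayExpect p fun ω => X g ω ^ 2)
        ≤ a g * (Real.sqrt (s ^ n * n.factorial) * (n : ℝ) ^ moved g) :=
          mul_le_mul_of_nonneg_left (hB g) (ha0 g)
      _ = Real.sqrt (s ^ n * n.factorial) * (η * n) ^ moved g := by rw [ha, mul_pow]; ring
  have step3 : ∑ g ∈ G, (η * n) ^ moved g ≤ 2 * (n : ℝ) ^ 2 * (η * n) :=
    sum_erase_id_pow_moved_le (by positivity) (by nlinarith)
  have hsum0 : 0 ≤ ∑ g ∈ G, a g * Real.sqrt (arrayExpect p fun ω => X g ω ^ 2) :=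
    Finset.sum_nonneg fun g _ => mul_nonneg (ha0 g) (Real.sqrt_nonneg _)
  calc arrayExpect p (fun ω : Fin n → Fin n → A => perturbSum η (seedMatrix y ω) ^ 2)
      ≤ (∑ g ∈ G, a g * Real.sqrt (arrayExpect p fun ω => X g ω ^ 2)) ^ 2 := step1
    _ ≤ (Real.sqrt (s ^ n * n.factorial) * (2 * (n : ℝ) ^ 2 * (η * n))) ^ 2 := by
        apply pow_le_pow_left₀ hsum0
        exact step2.trans (mul_le_mul_of_nonneg_left step3 (Real.sqrt_nonneg _))
    _ = 4 * η ^ 2 * (n : ℝ) ^ 6 * (s ^ n * n.factorial) := by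
        rw [mul_pow, Real.sq_sqrt (by positivity)]
        ring

end Moments

end Literature.LinearAlgebra.Matrix
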